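import Summits.BirchSwinnertonDyer.BirchSwinnertonDyer.Theorems.KolyvaginRoadThreePTDevissageUnipotentTwoFinal
import Literature.NumberTheory.GaloisRepresentations.SemiLocalUnits
import HarnessLib

/-!
# Milne *ADT* I Thm. 4.10(b) `Ker γ¹ ⊆ Im β¹` DESCENDS along a finite extension `K'/K` of degree prime
# to `p` — the assembly, modulo the semi-local corestriction package (stated as hypotheses)

Route `KolyvaginRoadThree`, crux `ZhangSharpFrameAtThreeHL` (stmt-BirchSwinnertonDyer-19574), the PT
road (koly g18 `MEMO-v9-PT-DEVISSAGE-g18.md` §7 (C), `PT-ROAD-DESIGN-g18.md` §C): after the dévissage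
(`middleExact_canonical_of_extension`) and the instance over the `p`-Sylow fixed field
(`middleExact_canonical_of_unipotentTwo_all`), what remains for `hE(E[p])` over `K` is the
prime-to-`p` DESCENT.  This file is the kernel certificate of the descent ARGUMENT: for number fields
`K`, `K'` (`[Algebra K K']`), a prime `p` with `H¹(K_v, M) = 0` at the infinite places `v` of `K`
(automatic for `p` odd or `K` totally complex), finite discrete modules `M` over `K` (`p`-torsion) and
`M'` over `K'`, and abstract
CORESTRICTION DATA — global `Cor : H¹(K', M') → H¹(K, M)`, `Cor^D : H¹(K', M'^D) → H¹(K, M^D)` and, at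
every finite place `w ∣ v`, local `Cor_{w/v}`, `Res_{w/v}`, `Cor^D_{w/v}` — satisfying
 (semi-local) `loc_v ∘ Cor = Σ_{w∣v} Cor_{w/v} ∘ loc_w` for `M` and for the duals,
 (degree)     `Σ_{w∣v} Cor_{w/v} (Res_{w/v} a) = d • a` with `p ∤ d` (`d = [K':K]`),
 (adjoint)    `⟨Res_{w/v} a, b'⟩_w = ⟨a, Cor^D_{w/v} b'⟩_v` for THE local Tate pairings
              (`LocalInvariants.canonical`),
 (unramified) `Cor_{w/v}`, `Cor^D_{w/v}` map unramified classes to unramified classes,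
 (places)     `M` unramified at `v` ⇒ `M'` unramified at every `w ∣ v`,
Milne I Thm. 4.10(b) for `M'` over `K'` at EVERY admissible finite set of places implies Milne I
Thm. 4.10(b) for `M` over `K` at every `S` off which `p` and `M` are unramified
(`middleExact_canonical_of_descentData`; the usual clause `S ⊇ {v ∣ ∞}` is not even needed).

The argument (Cassels–Fröhlich IV §6 / Serre, *Galois Cohomology* I §2.4, "restriction–corestriction"):
given `t = (t_v)_{v ∈ S}` orthogonal to `loc H¹_S(K, M^D)`, put `t'_w := Res_{w/v} t_v` at the finite
places of `K'` above `S` (and `0` at the infinite places); for `y' ∈ H¹_{S'}(K', M'^D)` the class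
`Cor^D y'` lies in `H¹_S(K, M^D)` (semi-local formula off `S` + (unramified)), and
`Σ_{w ∈ S'} ⟨t'_w, loc_w y'⟩_w = Σ_{v ∈ S} ⟨t_v, loc_v Cor^D y'⟩_v = 0` ((adjoint) + semi-local
formula on `S`); so `t' = loc x'` for some `x' ∈ H¹_{S'}(K', M')`, and `x := u • Cor x'` with
`u d ≡ 1 (mod p)` has `loc_v x = u • Σ_w Cor_{w/v} Res_{w/v} t_v = u d • t_v = t_v` on `S` and is
unramified off `S`.  THEOREMS ONLY; every hypothesis is a named binder (the bricks of the package land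
separately: the double-coset formula `Literature/…/ContinuousCorestrictionDoubleCoset.lean`, the field
corestriction `Literature/…/GaloisCohomologyCorestriction.lean`, …).  HONEST FRAMING: no case of BSD and no
new case of Poitou–Tate is proved here; this is the reduction of the descent to five local/semi-local
compatibilities.

References: [MilneADT2006] I Thm. 4.10(b); [SerreGaloisCohomology1997] I §2.4; [CasselsFrohlichANT1967]
Ch. IV §6 (Res, Cor), Ch. VII; [NeukirchSchmidtWingberg2008] (1.5.6)–(1.5.7), (8.3.20).
-/

noncomputable section

open CategoryTheory Function NumberField IsDedekindDomain
open scoped NumberField ContRepresentation Classical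

set_option linter.dupNamespace false
set_option autoImplicit false

namespace Summit.BirchSwinnertonDyer.BirchSwinnertonDyer.Theorems.KolyvaginRoadThreePT

open Field
open Literature.NumberTheory.GaloisRepresentations Literature.NumberTheory.GaloisCohomology
open Literature.NumberTheory.GaloisRepresentations.DiscreteGaloisModule (mu MuCarrier TateDual tateDual
  localTatePairingZMod unramifiedSubgroup SelmerStructure)
open Literature.NumberTheory.GaloisRepresentations.SemiLocal (Place)
open _root_.TopRep _root_.ContRepresentation _root_.ContinuousCohomology

section Descent

variable {K K' : Type} [Field K] [NumberField K] [Field K'] [NumberField K'] [Algebra K K']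
variable {p : ℕ} [hp : Fact p.Prime]
variable {M : Type} [AddCommGroup M] [TopologicalSpace M] [DiscreteTopology M] [Finite M]
variable {M' : Type} [AddCommGroup M'] [TopologicalSpace M'] [DiscreteTopology M'] [Finite M']

omit [NumberField K] [Finite M] in
/-- `H¹(F, X)` is killed by `n` when `X` is (classes of cocycles killed pointwise).
[cite: SerreGaloisCohomology1997, I §2.2] -/
theorem galoisCohomology_one_nsmul_eq_zero {F : Type} [Field F] {n : ℕ}
    (ρ : DiscreteGaloisModule F M) (hM : ∀ m : M, n • m = 0) (c : galoisCohomology ρ 1) :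
    n • c = 0 := by
  obtain ⟨f, rfl⟩ := oneCocycleClass_surjective ρ.toTopRep c
  have hf : n • f = 0 := Subtype.ext (ContinuousMap.ext fun σ => by
    change n • f.1 σ = 0
    exact hM _)
  change n • oneCocycleClassₗ ρ.toTopRep f = (0 : (continuousCohomology 1 ρ.toTopRep : TopModuleCat ℤ))
  rw [← map_nsmul, hf, map_zero]

omit [NumberField K] [NumberField K'] hp in
/-- A finite place `w` of `K'` lies above the finite place `w ∩ 𝓞_K` of `K`; if `p ∉ w ∩ 𝓞_K` then
`p ∉ w`. [folklore] -/
theorem natCast_not_mem_of_under {w : HeightOneSpectrum (𝓞 K')} {v : HeightOneSpectrum (𝓞 K)}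
    (hw : w.under (𝓞 K) = v) (hv : ((p : ℕ) : 𝓞 K) ∉ v.asIdeal) : ((p : ℕ) : 𝓞 K') ∉ w.asIdeal := by
  intro h
  apply hv
  rw [← hw]
  change algebraMap (𝓞 K) (𝓞 K') (p : 𝓞 K) ∈ w.asIdeal
  rwa [map_natCast]

/-- **Milne I Thm. 4.10(b) descends along `K'/K` of degree prime to `p`, given the corestriction
package.**  See the module docstring for the data and the five compatibilities; `hE'` is Milne I
4.10(b) for `M'` over `K'` (THE invariant maps `LocalInvariants.canonical K' p`) at every admissible
`S'`, and the conclusion is the same statement for `M` over `K` at the admissible `S`.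
[cite: MilneADT2006, Ch. I, Thm. 4.10(b)] [cite: SerreGaloisCohomology1997, I §2.4] -/
theorem middleExact_canonical_of_descentData
    (ρ : DiscreteGaloisModule K M) (ρ' : DiscreteGaloisModule K' M')
    (hpM : ∀ m : M, p • m = 0) {d : ℕ} (hd : p.Coprime d)
    -- the corestriction data
    (CorG : galoisCohomology ρ' 1 →+ galoisCohomology ρ 1)
    (CorGD : galoisCohomology (ρ'.tateDual p) 1 →+ galoisCohomology (ρ.tateDual p) 1)
    (Cor : ∀ (v : HeightOneSpectrum (𝓞 K)) (w : Place K K' v),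
      galoisCohomology (ρ'.toLocal (Sum.inr (w : HeightOneSpectrum (𝓞 K')))) 1 →+
        galoisCohomology (ρ.toLocal (Sum.inr v)) 1)
    (Res : ∀ (v : HeightOneSpectrum (𝓞 K)) (w : Place K K' v),
      galoisCohomology (ρ.toLocal (Sum.inr v)) 1 →+
        galoisCohomology (ρ'.toLocal (Sum.inr (w : HeightOneSpectrum (𝓞 K')))) 1)
    (CorD : ∀ (v : HeightOneSpectrum (𝓞 K)) (w : Place K K' v),
      galoisCohomology ((ρ'.tateDual p).toLocal (Sum.inr (w : HeightOneSpectrum (𝓞 K')))) 1 →+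
        galoisCohomology ((ρ.tateDual p).toLocal (Sum.inr v)) 1)
    -- (semi-local) for `M` and for the duals
    (hsemi : ∀ (v : HeightOneSpectrum (𝓞 K)) (y' : galoisCohomology ρ' 1),
      galoisCohomology.localization ρ (Sum.inr v) 1 (CorG y') =
        ∑ w : Place K K' v, Cor v w
          (galoisCohomology.localization ρ' (Sum.inr (w : HeightOneSpectrum (𝓞 K'))) 1 y'))
    (hsemiD : ∀ (v : HeightOneSpectrum (𝓞 K)) (y' : galoisCohomology (ρ'.tateDual p) 1),
      galoisCohomology.localization (ρ.tateDual p) (Sum.inr v) 1 (CorGD y') =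
        ∑ w : Place K K' v, CorD v w
          (galoisCohomology.localization (ρ'.tateDual p) (Sum.inr (w : HeightOneSpectrum (𝓞 K'))) 1 y'))
    -- (degree)
    (hdeg : ∀ (v : HeightOneSpectrum (𝓞 K)) (a : galoisCohomology (ρ.toLocal (Sum.inr v)) 1),
      ∑ w : Place K K' v, Cor v w (Res v w a) = d • a)
    -- (adjoint)
    (hadj : ∀ (v : HeightOneSpectrum (𝓞 K)) (w : Place K K' v)
      (a : galoisCohomology (ρ.toLocal (Sum.inr v)) 1)
      (b' : galoisCohomology ((ρ'.tateDual p).toLocal (Sum.inr (w : HeightOneSpectrum (𝓞 K')))) 1),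
      localTatePairingZMod ρ' p (Sum.inr (w : HeightOneSpectrum (𝓞 K')))
          (LocalInvariants.canonical K' p (Sum.inr (w : HeightOneSpectrum (𝓞 K')))) (Res v w a) b' =
        localTatePairingZMod ρ p (Sum.inr v) (LocalInvariants.canonical K p (Sum.inr v)) a (CorD v w b'))
    -- (unramified)
    (hur : ∀ (v : HeightOneSpectrum (𝓞 K)) (w : Place K K' v)
      (z' : galoisCohomology (ρ'.toLocal (Sum.inr (w : HeightOneSpectrum (𝓞 K')))) 1),
      z' ∈ unramifiedSubgroup (GaloisRep.toLocal (w : HeightOneSpectrum (𝓞 K')) ρ') 1 →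
        Cor v w z' ∈ unramifiedSubgroup (GaloisRep.toLocal v ρ) 1)
    (hurD : ∀ (v : HeightOneSpectrum (𝓞 K)) (w : Place K K' v)
      (z' : galoisCohomology ((ρ'.tateDual p).toLocal (Sum.inr (w : HeightOneSpectrum (𝓞 K')))) 1),
      z' ∈ unramifiedSubgroup (GaloisRep.toLocal (w : HeightOneSpectrum (𝓞 K')) (ρ'.tateDual p)) 1 →
        CorD v w z' ∈ unramifiedSubgroup (GaloisRep.toLocal v (ρ.tateDual p)) 1)
    -- (places) and the infinite places
    (hram : ∀ (v : HeightOneSpectrum (𝓞 K)) (w : Place K K' v), GaloisRep.IsUnramifiedAt v ρ →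
      GaloisRep.IsUnramifiedAt (w : HeightOneSpectrum (𝓞 K')) ρ')
    (hKinf : ∀ (w : InfinitePlace K) (a : galoisCohomology (ρ.toLocal (Sum.inl w)) 1), a = 0)
    -- Milne I 4.10(b) over `K'`, all admissible `S'`
    (hE' : ∀ (S' : Finset (Place K')), (∀ w : InfinitePlace K', (Sum.inl w : Place K') ∈ S') →
      (∀ w : HeightOneSpectrum (𝓞 K'), (Sum.inr w : Place K') ∉ S' →
        ((p : ℕ) : 𝓞 K') ∉ w.asIdeal ∧ GaloisRep.IsUnramifiedAt w ρ') →
      ∀ t' : Π w : Place K', galoisCohomology (ρ'.toLocal w) 1,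
      (∀ y' : galoisCohomology (ρ'.tateDual p) 1,
        (∀ w : HeightOneSpectrum (𝓞 K'), (Sum.inr w : Place K') ∉ S' →
          galoisCohomology.localization (ρ'.tateDual p) (Sum.inr w) 1 y' ∈
            unramifiedSubgroup (GaloisRep.toLocal w (ρ'.tateDual p)) 1) →
        ∑ w ∈ S', localTatePairingZMod ρ' p w (LocalInvariants.canonical K' p w) (t' w)
          (galoisCohomology.localization (ρ'.tateDual p) w 1 y') = 0) →
      ∃ x' : galoisCohomology ρ' 1,
        (∀ w : HeightOneSpectrum (𝓞 K'), (Sum.inr w : Place K') ∉ S' →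
          galoisCohomology.localization ρ' (Sum.inr w) 1 x' ∈
            unramifiedSubgroup (GaloisRep.toLocal w ρ') 1) ∧
        ∀ w ∈ S', galoisCohomology.localization ρ' w 1 x' = t' w)
    -- the admissible `S` over `K` and the datum
    {S : Finset (Place K)}
    (hS : ∀ v : HeightOneSpectrum (𝓞 K), (Sum.inr v : Place K) ∉ S →
      ((p : ℕ) : 𝓞 K) ∉ v.asIdeal ∧ GaloisRep.IsUnramifiedAt v ρ)
    (t : Π v : Place K, galoisCohomology (ρ.toLocal v) 1)
    (horth : ∀ y : galoisCohomology (ρ.tateDual p) 1,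
      (∀ v : HeightOneSpectrum (𝓞 K), (Sum.inr v : Place K) ∉ S →
        galoisCohomology.localization (ρ.tateDual p) (Sum.inr v) 1 y ∈
          unramifiedSubgroup (GaloisRep.toLocal v (ρ.tateDual p)) 1) →
      ∑ v ∈ S, localTatePairingZMod ρ p v (LocalInvariants.canonical K p v) (t v)
        (galoisCohomology.localization (ρ.tateDual p) v 1 y) = 0) :
    ∃ x : galoisCohomology ρ 1,
      (∀ v : HeightOneSpectrum (𝓞 K), (Sum.inr v : Place K) ∉ S →
        galoisCohomology.localization ρ (Sum.inr v) 1 x ∈ unramifiedSubgroup (GaloisRep.toLocal v ρ) 1) ∧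
      ∀ v ∈ S, galoisCohomology.localization ρ v 1 x = t v := by
  classical
  -- the admissible set `S' = {w ∣ ∞} ∪ {w ∣ v : v ∈ S}` over `K'`
  let above : Place K → Finset (Place K') := fun s =>
    match s with
    | Sum.inl _ => ∅
    | Sum.inr v => (Finset.univ : Finset (Place K K' v)).image
        fun w : Place K K' v => (Sum.inr (w : HeightOneSpectrum (𝓞 K')) : Place K')
  have habove_inl : ∀ w : InfinitePlace K, above (Sum.inl w) = ∅ := fun _ => rfl
  have habove_inr : ∀ v : HeightOneSpectrum (𝓞 K), above (Sum.inr v) =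
      (Finset.univ : Finset (Place K K' v)).image
        fun w : Place K K' v => (Sum.inr (w : HeightOneSpectrum (𝓞 K')) : Place K') := fun _ => rfl
  set S' : Finset (Place K') :=
    (Finset.univ : Finset (InfinitePlace K')).image (fun w => (Sum.inl w : Place K')) ∪ S.biUnion above
    with hS'_def
  have hS'inf : ∀ w : InfinitePlace K', (Sum.inl w : Place K') ∈ S' := fun w => by
    rw [hS'_def, Finset.mem_union]
    exact Or.inl (Finset.mem_image.mpr ⟨w, Finset.mem_univ _, rfl⟩)
  have hS'mem : ∀ w : HeightOneSpectrum (𝓞 K'),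
      (Sum.inr w : Place K') ∈ S' ↔ (Sum.inr (w.under (𝓞 K)) : Place K) ∈ S := fun w => by
    rw [hS'_def, Finset.mem_union, Finset.mem_biUnion]
    constructor
    · rintro (h | ⟨s, hs, hw⟩)
      · obtain ⟨winf, -, h⟩ := Finset.mem_image.mp h
        exact absurd h (by simp)
      · rcases s with winf | v
        · rw [habove_inl winf] at hw
          exact absurd hw (Finset.notMem_empty _)
        · rw [habove_inr] at hw
          obtain ⟨w', -, hw'⟩ := Finset.mem_image.mp hw
          have heq : (w' : HeightOneSpectrum (𝓞 K')) = w := Sum.inr_injective hw'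
          rw [← heq, w'.under_eq]
          exact hs
    · intro h
      refine Or.inr ⟨Sum.inr (w.under (𝓞 K)), h, ?_⟩
      rw [habove_inr]
      exact Finset.mem_image.mpr ⟨⟨w, rfl⟩, Finset.mem_univ _, rfl⟩
  -- sums over `S'` of functions vanishing at the infinite places
  have hsum : ∀ (F : Place K' → ZMod p), (∀ w : InfinitePlace K', F (Sum.inl w) = 0) →
      ∑ s' ∈ S', F s' =
        ∑ s ∈ S, match s with
          | Sum.inl _ => (0 : ZMod p)
          | Sum.inr v => ∑ w : Place K K' v, F (Sum.inr (w : HeightOneSpectrum (𝓞 K'))) := by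
    intro F hF
    rw [hS'_def, Finset.sum_union]
    · have h1 : ∑ x ∈ (Finset.univ : Finset (InfinitePlace K')).image (fun w => (Sum.inl w : Place K')),
          F x = 0 := Finset.sum_eq_zero fun x hx => by
        obtain ⟨w, -, rfl⟩ := Finset.mem_image.mp hx
        exact hF w
      rw [h1, zero_add, Finset.sum_biUnion]
      · refine Finset.sum_congr rfl fun s _ => ?_
        rcases s with winf | v
        · rw [habove_inl winf, Finset.sum_empty]
        · rw [habove_inr, Finset.sum_image]
          intro w _ w' _ h
          exact SemiLocal.Place.ext (Sum.inr_injective h)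
      · intro s _ s' _ hss'
        rcases s with winf | v <;> rcases s' with winf' | v'
        · exact Finset.disjoint_empty_left _
        · exact Finset.disjoint_empty_left _
        · exact Finset.disjoint_empty_right _
        · change Disjoint (above (Sum.inr v)) (above (Sum.inr v'))
          rw [Finset.disjoint_left]
          intro x hx hx'
          rw [habove_inr] at hx hx'
          obtain ⟨w, -, rfl⟩ := Finset.mem_image.mp hx
          obtain ⟨w', -, hw'⟩ := Finset.mem_image.mp hx'
          apply hss'
          have heq : (w' : HeightOneSpectrum (𝓞 K')) = w := Sum.inr_injective hw'
          rw [← w.under_eq, ← w'.under_eq, heq]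
    · rw [Finset.disjoint_left]
      intro x hx hx'
      obtain ⟨w, -, rfl⟩ := Finset.mem_image.mp hx
      obtain ⟨s, -, hs⟩ := Finset.mem_biUnion.mp hx'
      rcases s with winf | v
      · rw [habove_inl winf] at hs
        exact absurd hs (Finset.notMem_empty _)
      · rw [habove_inr] at hs
        obtain ⟨w', -, hw'⟩ := Finset.mem_image.mp hs
        exact absurd hw' (by simp)
  have hS' : ∀ w : HeightOneSpectrum (𝓞 K'), (Sum.inr w : Place K') ∉ S' →
      ((p : ℕ) : 𝓞 K') ∉ w.asIdeal ∧ GaloisRep.IsUnramifiedAt w ρ' := fun w hw => by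
    rw [hS'mem] at hw
    obtain ⟨hpv, hurv⟩ := hS _ hw
    exact ⟨natCast_not_mem_of_under rfl hpv, hram _ ⟨w, rfl⟩ hurv⟩
  -- the family `t'` over `K'`
  let t' : Π w : Place K', galoisCohomology (ρ'.toLocal w) 1 := fun w =>
    match w with
    | Sum.inl _ => 0
    | Sum.inr w => Res (w.under (𝓞 K)) ⟨w, rfl⟩ (t (Sum.inr (w.under (𝓞 K))))
  have ht'inr : ∀ (v : HeightOneSpectrum (𝓞 K)) (w : Place K K' v),
      t' (Sum.inr (w : HeightOneSpectrum (𝓞 K'))) = Res v w (t (Sum.inr v)) := by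
    rintro v ⟨w, rfl⟩
    rfl
  -- `t'` is orthogonal to `loc H¹_{S'}(K', M'^D)`
  have horth' : ∀ y' : galoisCohomology (ρ'.tateDual p) 1,
      (∀ w : HeightOneSpectrum (𝓞 K'), (Sum.inr w : Place K') ∉ S' →
        galoisCohomology.localization (ρ'.tateDual p) (Sum.inr w) 1 y' ∈
          unramifiedSubgroup (GaloisRep.toLocal w (ρ'.tateDual p)) 1) →
      ∑ w ∈ S', localTatePairingZMod ρ' p w (LocalInvariants.canonical K' p w) (t' w)
        (galoisCohomology.localization (ρ'.tateDual p) w 1 y') = 0 := by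
    intro y' hy'
    -- `Cor^D y'` is unramified outside `S`
    have hY : ∀ v : HeightOneSpectrum (𝓞 K), (Sum.inr v : Place K) ∉ S →
        galoisCohomology.localization (ρ.tateDual p) (Sum.inr v) 1 (CorGD y') ∈
          unramifiedSubgroup (GaloisRep.toLocal v (ρ.tateDual p)) 1 := fun v hv => by
      rw [hsemiD]
      refine AddSubgroup.sum_mem _ fun w _ => hurD v w _ (hy' _ ?_)
      rw [hS'mem, w.under_eq]
      exact hv
    have h0 := horth (CorGD y') hY
    rw [hsum _ (fun w => by rw [show t' (Sum.inl w) = 0 from rfl, map_zero, AddMonoidHom.zero_apply])]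
    refine (Finset.sum_congr rfl fun s hs => ?_).trans h0
    rcases s with winf | v
    · change (0 : ZMod p) = _
      rw [hKinf winf (t (Sum.inl winf)), map_zero, AddMonoidHom.zero_apply]
    · change ∑ w : Place K K' v, _ = _
      rw [hsemiD, map_sum]
      refine Finset.sum_congr rfl fun w _ => ?_
      rw [ht'inr, hadj]
  -- the class over `K'`
  obtain ⟨x', hx'ur, hx'S⟩ := hE' S' hS'inf hS' t' horth'
  -- `u d ≡ 1 (mod p)`
  obtain ⟨u, hu⟩ : ∃ u : ℕ, u * d % p = 1 := by
    have h1 : Nat.Coprime d p := hd.symm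
    haveI : NeZero p := ⟨hp.out.ne_zero⟩
    refine ⟨(ZMod.unitOfCoprime d h1)⁻¹.val.val, ?_⟩
    have h2 : (((ZMod.unitOfCoprime d h1)⁻¹.val.val * d : ℕ) : ZMod p) = 1 := by
      rw [Nat.cast_mul, ZMod.natCast_zmod_val, ← ZMod.coe_unitOfCoprime d h1, Units.inv_mul]
    have h3 := congrArg ZMod.val h2
    rwa [ZMod.val_natCast, ZMod.val_one_eq_one_mod, Nat.mod_eq_of_lt hp.out.one_lt] at h3
  refine ⟨u • CorG x', fun v hv => ?_, fun v hv => ?_⟩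
  · -- unramified outside `S`
    rw [map_nsmul, hsemi]
    refine AddSubgroup.nsmul_mem _ (AddSubgroup.sum_mem _ fun w _ => hur v w _ (hx'ur _ ?_)) u
    rw [hS'mem, w.under_eq]
    exact hv
  · -- `loc_v x = t_v` on `S`
    rcases v with winf | v
    · rw [hKinf winf (t (Sum.inl winf))]
      exact hKinf winf _
    · rw [map_nsmul, hsemi]
      have hw : ∀ w : Place K K' v,
          galoisCohomology.localization ρ' (Sum.inr (w : HeightOneSpectrum (𝓞 K'))) 1 x' =
            Res v w (t (Sum.inr v)) := fun w => by
        rw [← ht'inr]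
        refine hx'S _ ?_
        rw [hS'mem, w.under_eq]
        exact hv
      simp only [hw]
      rw [hdeg, ← mul_nsmul']
      -- `(u * d) • t_v = t_v` since `p • t_v = 0` and `u d ≡ 1 (mod p)`
      have hpt : p • t (Sum.inr v) = 0 := galoisCohomology_one_nsmul_eq_zero _ hpM _
      conv_rhs => rw [← one_nsmul (t (Sum.inr v))]
      rw [← Nat.div_add_mod (u * d) p, hu, add_nsmul, mul_nsmul, hpt, nsmul_zero, zero_add]

end Descent

end Summit.BirchSwinnertonDyer.BirchSwinnertonDyer.Theorems.KolyvaginRoadThreePT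

end
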